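import Summits.CriticalPhenomena.PercolationContinuityZ3.Theorems.PercNearOneGluingNoHeavyLowerTailSunflowerCoreCounts
import HarnessLib
import HarnessLib.Audit

/-!
# `NoHeavyLowerTail` (crux stmt-CriticalPhenomena-4575), abstract sunflower cubic: the partition lemma ★ as a MATCHING of ordered
# 3-partitions (`StarMatching`, typed conjecture) and the reduction `StarMatching → PartitionLemmaH`

Support file (seat `prim-l12-p2` gen 17; `--supports stmt-CriticalPhenomena-4575`).  No `sorry`.  The `@[conjecture]` definition is an
obligation of this programme (census-true, unproved), never a fact — it is used only as an explicit hypothesis.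
Memo: run/shared/lean/prim/prim-l12/prim-l12-p2/FINDING-g17-HALL-GLADKOV-PROVED.md (§6).

COUNTING FORM OF ★.  With `N(x,y,z)` the number of ORDERED 3-partitions `(P,Q,R)` of the ground set with label word `(lab P, lab Q, lab R) = (x,y,z)`
(`4` = kernel `A`, `0` = bottom `B`, `1,2,3` the petals), the kernel `s6H` is the symmetrisation of `[supply word] − [demand word]` where the
SUPPLY words are `(4,4,0), (4,0,0)` and the DEMAND words are `(1,2,3)`, `(4,i,j)`, `(0,i,j)` (`i < j` petals) (`s6H_eq_symm6`), so that
`ZH = 6·(#SUP − #DEM)` (`Sunflower.ZH_eq_six_card_sup_sub_dem`) and ★ ⟺ `#DEM ≤ #SUP`.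
THE MATCHING CONJECTURE `StarMatching` (this work; census below): `DEM` injects into `SUP` along the relation
  `(P,Q,R) ↦ (P',Q',R')` with `P ⊆ P'` and `R' ⊆ R`   ("the left block only grows — into the kernel —, the right block only shrinks — to the
bottom —, the middle block is free"; in the encoding of `parts` by disjoint pairs `(P,Q)`: `P ⊆ P'` and `P ∪ Q ⊆ P' ∪ Q'`).  It is the three-block
analogue of the (now proved) Gladkov / Hall–Gladkov matchings: for a kernel or bottom spectator in the middle the same relation with the middle
block fixed is exactly Gladkov's two-petal matching of the spectator cube, and these restricted systems are simultaneously feasible together with the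
rainbows (memo §6).  `partitionLemmaH_of_starMatching`: the conjecture implies ★ (`PartitionLemmaH`) by `#DEM ≤ #SUP`.
CENSUS (this gen, code-g17/star2–star12): all sunflowers with three nonempty petals on 4 points (2 022 up to the order of the petal triple), 1.3·10⁵
random θ-pullbacks on 5–6 points, 2·10⁴ on 7 points, the doubled star (6 points) and the three-hub sunflower TH(4) (7 points): a matching exists in
every instance (0 Hall failures); the variants with the spectator block placed in the middle or on the right and kept FIXED for spectator demands are
also feasible throughout.  The plain 0/1 relation matrix is NOT always of full rank (≈ 4 % of instances: two demands with identical neighbourhoods),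
so — unlike Hall–Gladkov — this is not a GF(2)-rank phenomenon of the bare relation.
-/

namespace Summit.CriticalPhenomena.PercolationContinuityZ3.Theorems.SunflowerPartition

open Finset

/-! ## Supply and demand words -/

/-- Indicator of the SUPPLY words `(4,4,0)` and `(4,0,0)`. [this work] -/
def supInd (x y z : Fin 5) : ℤ := if x = 4 ∧ (y = 4 ∨ y = 0) ∧ z = 0 then 1 else 0

/-- Indicator of the DEMAND words `(1,2,3)`, `(4,i,j)`, `(0,i,j)` with petals `i < j`. [this work] -/
def demInd (x y z : Fin 5) : ℤ :=
  if (x = 1 ∧ y = 2 ∧ z = 3) ∨ ((x = 4 ∨ x = 0) ∧ (y = 1 ∨ y = 2 ∨ y = 3) ∧ (z = 1 ∨ z = 2 ∨ z = 3) ∧ y < z) then 1 else 0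

/-- `s6H` is the symmetrisation of `supInd − demInd` over the six block orders (in the order of `sum_parts_symm6`). [this work] -/
theorem s6H_eq_symm6 : ∀ x y z : Fin 5,
    s6H x y z = (supInd x y z - demInd x y z) + (supInd x z y - demInd x z y) + (supInd y x z - demInd y x z)
      + (supInd y z x - demInd y z x) + (supInd z x y - demInd z x y) + (supInd z y x - demInd z y x) := by
  decide

/-- `supInd` is an indicator. [this work] -/
theorem supInd_eq_ite : ∀ x y z : Fin 5, supInd x y z = if supInd x y z = 1 then 1 else 0 := by decide

/-- `demInd` is an indicator. [this work] -/
theorem demInd_eq_ite : ∀ x y z : Fin 5, demInd x y z = if demInd x y z = 1 then 1 else 0 := by decide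

namespace Sunflower

variable {α : Type*} [Fintype α] [DecidableEq α] (F : Sunflower α)

/-- The DEMAND partitions: ordered 3-partitions `(P,Q,(P∪Q)ᶜ)` with label word `(1,2,3)`, `(4,i,j)` or `(0,i,j)`, `i<j`. [this work] -/
def dem : Finset (Finset α × Finset α) :=
  (parts α).filter fun q => demInd (F.lab q.1) (F.lab q.2) (F.lab (q.1 ∪ q.2)ᶜ) = 1

/-- The SUPPLY partitions: ordered 3-partitions with label word `(4,4,0)` or `(4,0,0)`. [this work] -/
def sup : Finset (Finset α × Finset α) :=
  (parts α).filter fun q => supInd (F.lab q.1) (F.lab q.2) (F.lab (q.1 ∪ q.2)ᶜ) = 1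

/-- **`ZH = 6·(#SUP − #DEM)`.** [this work] -/
theorem ZH_eq_six_card_sup_sub_dem : F.ZH = 6 * ((F.sup.card : ℤ) - (F.dem.card : ℤ)) := by
  have hsym := sum_parts_symm6 (α := α) (fun x y z => supInd x y z - demInd x y z) F
  have hZ : F.ZH = ∑ q ∈ parts α, ((supInd (F.lab q.1) (F.lab q.2) (F.lab (q.1 ∪ q.2)ᶜ) - demInd (F.lab q.1) (F.lab q.2) (F.lab (q.1 ∪ q.2)ᶜ))
      + (supInd (F.lab q.1) (F.lab (q.1 ∪ q.2)ᶜ) (F.lab q.2) - demInd (F.lab q.1) (F.lab (q.1 ∪ q.2)ᶜ) (F.lab q.2))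
      + (supInd (F.lab q.2) (F.lab q.1) (F.lab (q.1 ∪ q.2)ᶜ) - demInd (F.lab q.2) (F.lab q.1) (F.lab (q.1 ∪ q.2)ᶜ))
      + (supInd (F.lab q.2) (F.lab (q.1 ∪ q.2)ᶜ) (F.lab q.1) - demInd (F.lab q.2) (F.lab (q.1 ∪ q.2)ᶜ) (F.lab q.1))
      + (supInd (F.lab (q.1 ∪ q.2)ᶜ) (F.lab q.1) (F.lab q.2) - demInd (F.lab (q.1 ∪ q.2)ᶜ) (F.lab q.1) (F.lab q.2))
      + (supInd (F.lab (q.1 ∪ q.2)ᶜ) (F.lab q.2) (F.lab q.1) - demInd (F.lab (q.1 ∪ q.2)ᶜ) (F.lab q.2) (F.lab q.1))) := by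
    unfold Sunflower.ZH
    exact sum_congr rfl fun q _ => s6H_eq_symm6 _ _ _
  rw [hZ, ← hsym, sum_sub_distrib]
  have hs : ∑ q ∈ parts α, supInd (F.lab q.1) (F.lab q.2) (F.lab (q.1 ∪ q.2)ᶜ) = (F.sup.card : ℤ) := by
    unfold Sunflower.sup
    rw [← Finset.sum_boole]
    exact sum_congr rfl fun q _ => supInd_eq_ite _ _ _
  have hd : ∑ q ∈ parts α, demInd (F.lab q.1) (F.lab q.2) (F.lab (q.1 ∪ q.2)ᶜ) = (F.dem.card : ℤ) := by
    unfold Sunflower.dem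
    rw [← Finset.sum_boole]
    exact sum_congr rfl fun q _ => demInd_eq_ite _ _ _
  rw [hs, hd]

end Sunflower

/-! ## The matching conjecture and the reduction -/

/-- **STAR MATCHING** (this work; OPEN, census-clean — see the file header): for every sunflower, the demand partitions inject into the supply
partitions along "left block grows, right block shrinks": there is `φ : DEM → SUP`, injective, with `P ⊆ P'` and `P ∪ Q ⊆ P' ∪ Q'` for
`φ (P,Q) = (P',Q')` (third blocks `R = (P∪Q)ᶜ ⊇ R'`).  An obligation, never a fact: use as `(h : StarMatching)`. [status: open] -/
@[conjecture] def StarMatching : Prop :=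
  ∀ (α : Type) [Fintype α] [DecidableEq α] (F : Sunflower α),
    ∃ φ : Finset α × Finset α → Finset α × Finset α, Set.InjOn φ (F.dem : Set (Finset α × Finset α)) ∧
      ∀ q ∈ F.dem, φ q ∈ F.sup ∧ q.1 ⊆ (φ q).1 ∧ q.1 ∪ q.2 ⊆ (φ q).1 ∪ (φ q).2

/-- **`StarMatching → PartitionLemmaH`**: an injection `DEM ↪ SUP` gives `#DEM ≤ #SUP`, i.e. `0 ≤ ZH = 6·(#SUP − #DEM)`. [this work] -/
theorem partitionLemmaH_of_starMatching (h : StarMatching) : PartitionLemmaH := by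
  intro α _ _ F
  obtain ⟨φ, hinj, hφ⟩ := h α F
  have hle : F.dem.card ≤ F.sup.card :=
    Finset.card_le_card_of_injOn φ (fun q hq => (hφ q hq).1) hinj
  rw [F.ZH_eq_six_card_sup_sub_dem]
  have : (F.dem.card : ℤ) ≤ (F.sup.card : ℤ) := by exact_mod_cast hle
  linarith

end Summit.CriticalPhenomena.PercolationContinuityZ3.Theorems.SunflowerPartition
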